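import Summits.ValiantsHypothesis.ValiantsHypothesis.Theorems.GrenetZeonDualUnipotentThreeHalvesHeavyTopInstFourSevenBlocks

/-!
# `GrenetZeon.DualUnipotentThreeHalves` (stmt-ValiantsHypothesis-24318) — successor line `slow_core`, the format `(4,7)` in POWER currency:
# helper A — the BUDGET-TWO (CUBE) TREE of ✓ `no_wordTame_two_NSeven` re-plumbed to the hypothesis power currency supplies

Experiment cell «val-heavytop-census» (D-0160), engine seat val-htc-eng-1 g2 (kernel-only lane, director-valiant g17 R315 (4)).
Part of the chain `…SlowFourSeven{Square, Cube, Line}` → `…/Negative/SlowFourSeven` (`¬ Slow 4 7 NSeven`).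

In power currency with budget `k = 2` a direction space `K` (`dim K ≥ 13`) makes every entry of `(Q(x) + s·Q(v))³`, `v ∈ K`, of
`s`-degree `≤ 2` (`Q = topSeven`); at `x = 0` the `s³`-coefficient is `Q(v)³`, so `Q(v)³ = 0` on `K` — exactly the input the
word-currency tree of ✓ `no_wordTame_two_NSeven` (val-port-2 g2, ✓ `…/Negative/HeavyTopInstFourSeven`) consumes after its first step.
THIS FILE is that tree with `Q(v)³ = 0` taken as the hypothesis:

* `no_cubeZero_NSeven` — `dim K > 12` and `Q(v)³ = 0` for `v ∈ K` ⇒ `False` (the entries `(Q³)_{i,i+3} = x_i x_{i+1} x_{i+2}` kill a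
  set of first-superdiagonal coordinates meeting the four windows; the six minimal cases die by `(Q³)_{i,i+4}`, `(Q³)_{0,5}`: a
  monomial, a coordinate times a split rank-four quadric (✓ `finrank_le_of_isotropic`), or saturation (✓ `mem_of_forall_apply_eq_zero_of_le`)
  and an explicit top with non-zero cube; proof text = ✓ `no_wordTame_two_NSeven`'s, verbatim, credited).

Honest framing: bookkeeping for ONE tiny format in the successor currency (`--supports stmt-ValiantsHypothesis-24318 --as helper`);
nothing here asserts or refutes R2ᵖ `HeavyTopSlowLaw`, S3, IRR/RED, the crux, 8062 or `VP ≠ VNP` — all OPEN / NOT proved.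
[✓ `…/Negative/HeavyTopInstFourSeven` (val-port-2 g2); ✓ `…HeavyTopInstFourSevenToolkit`; this seat]
-/

set_option linter.dupNamespace false
set_option autoImplicit false

noncomputable section

namespace Summit.ValiantsHypothesis.ValiantsHypothesis.Theorems.GrenetZeon.SlowFourSeven

open MvPolynomial Matrix
open scoped BigOperators
open Summit.ValiantsHypothesis.ValiantsHypothesis.Theorems.GrenetZeon.RadicalSplit

/-- **The cube tree in power currency**: no direction space `K` of dimension `> 12` has `Q(v)³ = 0` for all `v ∈ K` (`Q = topSeven`).
[tree verbatim from ✓ `no_wordTame_two_NSeven`, val-port-2 g2] -/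
theorem no_cubeZero_NSeven (K : Submodule ℂ (Fin 4 × Fin 4 → ℂ)) (hdim : 12 < Module.finrank ℂ K)
    (hcube : ∀ v ∈ K, topSeven v * topSeven v * topSeven v = 0) : False := by
  classical
  have hcard : Fintype.card (Fin 4 × Fin 4) = 16 := by simp
  -- the cube entries we use
  have e03 : ∀ v ∈ K, v (0,0) * v (1,0) * v (2,0) = 0 := fun v hv => by
    have h := congr_fun (congr_fun (hcube v hv) 0) 3
    simp [topSeven, Matrix.mul_apply, Fin.sum_univ_seven, -mul_eq_zero] at h
    linear_combination h
  have e14 : ∀ v ∈ K, v (1,0) * v (2,0) * v (3,0) = 0 := fun v hv => by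
    have h := congr_fun (congr_fun (hcube v hv) 1) 4
    simp [topSeven, Matrix.mul_apply, Fin.sum_univ_seven, -mul_eq_zero] at h
    linear_combination h
  have e25 : ∀ v ∈ K, v (1,3) * v (2,0) * v (3,0) = 0 := fun v hv => by
    have h := congr_fun (congr_fun (hcube v hv) 2) 5
    simp [topSeven, Matrix.mul_apply, Fin.sum_univ_seven, -mul_eq_zero] at h
    linear_combination h
  have e36 : ∀ v ∈ K, v (1,3) * v (3,0) * v (3,3) = 0 := fun v hv => by
    have h := congr_fun (congr_fun (hcube v hv) 3) 6
    simp [topSeven, Matrix.mul_apply, Fin.sum_univ_seven, -mul_eq_zero] at h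
    linear_combination h
  have e04 : ∀ v ∈ K, v (0,0) * v (1,0) * v (2,1) + v (0,0) * v (1,1) * v (3,0) + v (0,1) * v (2,0) * v (3,0) = 0 :=
    fun v hv => by
    have h := congr_fun (congr_fun (hcube v hv) 0) 4
    simp [topSeven, Matrix.mul_apply, Fin.sum_univ_seven, -mul_eq_zero] at h
    linear_combination h
  have e15 : ∀ v ∈ K, v (1,0) * v (1,3) * v (2,1) + v (1,0) * v (2,0) * v (3,1) + v (1,1) * v (1,3) * v (3,0) = 0 :=
    fun v hv => by
    have h := congr_fun (congr_fun (hcube v hv) 1) 5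
    simp [topSeven, Matrix.mul_apply, Fin.sum_univ_seven, -mul_eq_zero] at h
    linear_combination h
  have e26 : ∀ v ∈ K, v (1,3) * v (2,1) * v (3,3) + v (2,0) * v (2,3) * v (3,0) + v (2,0) * v (3,1) * v (3,3) = 0 :=
    fun v hv => by
    have h := congr_fun (congr_fun (hcube v hv) 2) 6
    simp [topSeven, Matrix.mul_apply, Fin.sum_univ_seven, -mul_eq_zero] at h
    linear_combination h
  have e05 : ∀ v ∈ K, v (0,0) * v (1,0) * v (2,2) + v (0,0) * v (1,1) * v (3,1) + v (0,0) * v (1,2) * v (1,3) +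
      v (0,1) * v (1,3) * v (2,1) + v (0,1) * v (2,0) * v (3,1) + v (0,2) * v (1,3) * v (3,0) = 0 := fun v hv => by
    have h := congr_fun (congr_fun (hcube v hv) 0) 5
    simp [topSeven, Matrix.mul_apply, Fin.sum_univ_seven, -mul_eq_zero] at h
    linear_combination h
  -- closers
  have close4 : ∀ a b c d : Fin 4 × Fin 4, [a, b, c, d].Nodup → (∀ v ∈ K, v a = 0) → (∀ v ∈ K, v b = 0) →
      (∀ v ∈ K, v c = 0) → (∀ v ∈ K, v d = 0) → False := by
    intro a b c d hnd ha hb hc hd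
    have hle := finrank_add_length_le_of_forall_apply_eq_zero K [a, b, c, d] hnd (by
      intro v hv x hx
      simp only [List.mem_cons, List.mem_nil_iff, or_false] at hx
      rcases hx with rfl | rfl | rfl | rfl
      · exact ha v hv
      · exact hb v hv
      · exact hc v hv
      · exact hd v hv)
    simp only [List.length_cons, List.length_nil] at hle
    omega
  have closeIso : ∀ b c d e x y : Fin 4 × Fin 4, [b, c, d, e, x, y].Nodup →
      (∀ v ∈ K, v b * v c + v d * v e = 0) → (∀ v ∈ K, v x = 0) → (∀ v ∈ K, v y = 0) → False := by
    intro b c d e x y hnd hq hx hy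
    have hle := finrank_le_of_isotropic K b c d e [x, y] hnd hq (by
      intro v hv z hz
      simp only [List.mem_cons, List.mem_nil_iff, or_false] at hz
      rcases hz with rfl | rfl
      · exact hx v hv
      · exact hy v hv)
    simp only [List.length_cons, List.length_nil] at hle
    omega
  have closeWit : ∀ a b c : Fin 4 × Fin 4, [a, b, c].Nodup → (∀ v ∈ K, v a = 0) → (∀ v ∈ K, v b = 0) →
      (∀ v ∈ K, v c = 0) → ∀ u : Fin 4 × Fin 4 → ℂ, u a = 0 → u b = 0 → u c = 0 →
      topSeven u * topSeven u * topSeven u ≠ 0 → False := by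
    intro a b c hnd ha hb hc u hua hub huc hu
    refine hu (hcube u (mem_of_forall_apply_eq_zero_of_le K [a, b, c] hnd ?_ (by simp; omega) u ?_))
    · intro v hv x hx
      simp only [List.mem_cons, List.mem_nil_iff, or_false] at hx
      rcases hx with rfl | rfl | rfl
      · exact ha v hv
      · exact hb v hv
      · exact hc v hv
    · intro x hx
      simp only [List.mem_cons, List.mem_nil_iff, or_false] at hx
      rcases hx with rfl | rfl | rfl
      · exact hua
      · exact hub
      · exact huc
  -- the two explicit tops with nonzero cube: all second-superdiagonal letters, and `x₁ + x₂ + z₃`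
  obtain ⟨uY, huYdef⟩ : ∃ uY : Fin 4 × Fin 4 → ℂ,
      uY = fun p => if p = (0,1) ∨ p = (1,1) ∨ p = (2,1) ∨ p = (3,1) ∨ p = (2,3) then 1 else 0 := ⟨_, rfl⟩
  have huY : topSeven uY * topSeven uY * topSeven uY ≠ 0 := by
    intro h
    have h06 := congr_fun (congr_fun h 0) 6
    simp [topSeven, huYdef, Matrix.mul_apply, Fin.sum_univ_seven] at h06
  obtain ⟨uX, huXdef⟩ : ∃ uX : Fin 4 × Fin 4 → ℂ,
      uX = fun p => if p = (0,0) ∨ p = (1,0) ∨ p = (2,2) then 1 else 0 := ⟨_, rfl⟩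
  have huX : topSeven uX * topSeven uX * topSeven uX ≠ 0 := by
    intro h
    have h05 := congr_fun (congr_fun h 0) 5
    simp [topSeven, huXdef, Matrix.mul_apply, Fin.sum_univ_seven] at h05
  -- the four windows of the first superdiagonal
  have w1 := forall_apply_eq_zero_or₃ K (0,0) (1,0) (2,0) e03
  have w2 := forall_apply_eq_zero_or₃ K (1,0) (2,0) (3,0) e14
  have w3 := forall_apply_eq_zero_or₃ K (1,3) (2,0) (3,0) e25
  have w4 := forall_apply_eq_zero_or₃ K (1,3) (3,0) (3,3) e36
  -- Case analysis on the dead set Z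
  -- CASE {3,4}: x₃ = v(2,0), x₄ = v(3,0)
  have case34 : (∀ v ∈ K, v (2,0) = 0) → (∀ v ∈ K, v (3,0) = 0) → False := by
    intro dx3 dx4
    have m : ∀ v ∈ K, v (0,0) * v (1,0) * v (2,1) = 0 := fun v hv => by
      have h := e04 v hv
      rw [dx3 v hv, dx4 v hv] at h
      linear_combination h
    rcases forall_apply_eq_zero_or₃ K (0,0) (1,0) (2,1) m with dx1 | dx2 | dy3
    · have m2 : ∀ v ∈ K, v (1,0) * v (1,3) * v (2,1) = 0 := fun v hv => by
        have h := e15 v hv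
        rw [dx3 v hv, dx4 v hv] at h
        linear_combination h
      rcases forall_apply_eq_zero_or₃ K (1,0) (1,3) (2,1) m2 with dx2 | dx5 | dy3
      · exact close4 (2,0) (3,0) (0,0) (1,0) (by decide) dx3 dx4 dx1 dx2
      · exact close4 (2,0) (3,0) (0,0) (1,3) (by decide) dx3 dx4 dx1 dx5
      · exact close4 (2,0) (3,0) (0,0) (2,1) (by decide) dx3 dx4 dx1 dy3
    · have m2 : ∀ v ∈ K, v (1,3) * v (2,1) * v (3,3) = 0 := fun v hv => by
        have h := e26 v hv
        rw [dx3 v hv, dx4 v hv] at h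
        linear_combination h
      rcases forall_apply_eq_zero_or₃ K (1,3) (2,1) (3,3) m2 with dx5 | dy3 | dx6
      · exact close4 (2,0) (3,0) (1,0) (1,3) (by decide) dx3 dx4 dx2 dx5
      · exact close4 (2,0) (3,0) (1,0) (2,1) (by decide) dx3 dx4 dx2 dy3
      · exact close4 (2,0) (3,0) (1,0) (3,3) (by decide) dx3 dx4 dx2 dx6
    · exact closeWit (2,0) (3,0) (2,1) (by decide) dx3 dx4 dy3 uX
        (by simp [huXdef]) (by simp [huXdef]) (by simp [huXdef]) huX
  -- CASE {3,5}: x₃ = v(2,0), x₅ = v(1,3)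
  have case35 : (∀ v ∈ K, v (2,0) = 0) → (∀ v ∈ K, v (1,3) = 0) → False := by
    intro dx3 dx5
    have m : ∀ v ∈ K, v (0,0) * (v (1,0) * v (2,1) + v (1,1) * v (3,0)) = 0 := fun v hv => by
      have h := e04 v hv
      rw [dx3 v hv] at h
      linear_combination h
    rcases forall_apply_eq_zero_or_quad K (0,0) (1,0) (2,1) (1,1) (3,0) m with dx1 | hq
    · exact closeWit (2,0) (1,3) (0,0) (by decide) dx3 dx5 dx1 uY
        (by simp [huYdef]) (by simp [huYdef]) (by simp [huYdef]) huY
    · exact closeIso (1,0) (2,1) (1,1) (3,0) (2,0) (1,3) (by decide) hq dx3 dx5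
  -- CASE {3,6}: x₃ = v(2,0), x₆ = v(3,3)
  have case36 : (∀ v ∈ K, v (2,0) = 0) → (∀ v ∈ K, v (3,3) = 0) → False := by
    intro dx3 dx6
    have m : ∀ v ∈ K, v (0,0) * (v (1,0) * v (2,1) + v (1,1) * v (3,0)) = 0 := fun v hv => by
      have h := e04 v hv
      rw [dx3 v hv] at h
      linear_combination h
    have m2 : ∀ v ∈ K, v (1,3) * (v (1,0) * v (2,1) + v (1,1) * v (3,0)) = 0 := fun v hv => by
      have h := e15 v hv
      rw [dx3 v hv] at h
      linear_combination h
    rcases forall_apply_eq_zero_or_quad K (0,0) (1,0) (2,1) (1,1) (3,0) m with dx1 | hq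
    · rcases forall_apply_eq_zero_or_quad K (1,3) (1,0) (2,1) (1,1) (3,0) m2 with dx5 | hq
      · exact close4 (2,0) (3,3) (0,0) (1,3) (by decide) dx3 dx6 dx1 dx5
      · exact closeIso (1,0) (2,1) (1,1) (3,0) (2,0) (3,3) (by decide) hq dx3 dx6
    · exact closeIso (1,0) (2,1) (1,1) (3,0) (2,0) (3,3) (by decide) hq dx3 dx6
  -- CASE {2,4}: x₂ = v(1,0), x₄ = v(3,0)
  have case24 : (∀ v ∈ K, v (1,0) = 0) → (∀ v ∈ K, v (3,0) = 0) → False := by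
    intro dx2 dx4
    have m : ∀ v ∈ K, v (3,3) * (v (1,3) * v (2,1) + v (2,0) * v (3,1)) = 0 := fun v hv => by
      have h := e26 v hv
      rw [dx4 v hv] at h
      linear_combination h
    rcases forall_apply_eq_zero_or_quad K (3,3) (1,3) (2,1) (2,0) (3,1) m with dx6 | hq
    · exact closeWit (1,0) (3,0) (3,3) (by decide) dx2 dx4 dx6 uY
        (by simp [huYdef]) (by simp [huYdef]) (by simp [huYdef]) huY
    · exact closeIso (1,3) (2,1) (2,0) (3,1) (1,0) (3,0) (by decide) hq dx2 dx4
  -- CASE {2,5}: x₂ = v(1,0), x₅ = v(1,3)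
  have case25 : (∀ v ∈ K, v (1,0) = 0) → (∀ v ∈ K, v (1,3) = 0) → False := by
    intro dx2 dx5
    have m : ∀ v ∈ K, v (3,0) * (v (0,0) * v (1,1) + v (0,1) * v (2,0)) = 0 := fun v hv => by
      have h := e04 v hv
      rw [dx2 v hv] at h
      linear_combination h
    have m2 : ∀ v ∈ K, v (3,1) * (v (0,0) * v (1,1) + v (0,1) * v (2,0)) = 0 := fun v hv => by
      have h := e05 v hv
      rw [dx2 v hv, dx5 v hv] at h
      linear_combination h
    rcases forall_apply_eq_zero_or_quad K (3,0) (0,0) (1,1) (0,1) (2,0) m with dx4 | hq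
    · rcases forall_apply_eq_zero_or_quad K (3,1) (0,0) (1,1) (0,1) (2,0) m2 with dy4 | hq
      · exact close4 (1,0) (1,3) (3,0) (3,1) (by decide) dx2 dx5 dx4 dy4
      · exact closeIso (0,0) (1,1) (0,1) (2,0) (1,0) (1,3) (by decide) hq dx2 dx5
    · exact closeIso (0,0) (1,1) (0,1) (2,0) (1,0) (1,3) (by decide) hq dx2 dx5
  -- CASE {1,4}: x₁ = v(0,0), x₄ = v(3,0)
  have case14 : (∀ v ∈ K, v (0,0) = 0) → (∀ v ∈ K, v (3,0) = 0) → False := by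
    intro dx1 dx4
    have m : ∀ v ∈ K, v (1,0) * (v (1,3) * v (2,1) + v (2,0) * v (3,1)) = 0 := fun v hv => by
      have h := e15 v hv
      rw [dx4 v hv] at h
      linear_combination h
    have m2 : ∀ v ∈ K, v (3,3) * (v (1,3) * v (2,1) + v (2,0) * v (3,1)) = 0 := fun v hv => by
      have h := e26 v hv
      rw [dx4 v hv] at h
      linear_combination h
    rcases forall_apply_eq_zero_or_quad K (1,0) (1,3) (2,1) (2,0) (3,1) m with dx2 | hq
    · rcases forall_apply_eq_zero_or_quad K (3,3) (1,3) (2,1) (2,0) (3,1) m2 with dx6 | hq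
      · exact close4 (0,0) (3,0) (1,0) (3,3) (by decide) dx1 dx4 dx2 dx6
      · exact closeIso (1,3) (2,1) (2,0) (3,1) (0,0) (3,0) (by decide) hq dx1 dx4
    · exact closeIso (1,3) (2,1) (2,0) (3,1) (0,0) (3,0) (by decide) hq dx1 dx4
  -- the window tree
  by_cases dx3 : ∀ v ∈ K, v (2,0) = 0
  · rcases w4 with dx5 | dx4 | dx6
    · exact case35 dx3 dx5
    · exact case34 dx3 dx4
    · exact case36 dx3 dx6
  · rcases w2 with dx2 | h | dx4
    · by_cases dx4 : ∀ v ∈ K, v (3,0) = 0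
      · exact case24 dx2 dx4
      · rcases w3 with dx5 | h | h
        · exact case25 dx2 dx5
        · exact dx3 h
        · exact dx4 h
    · exact dx3 h
    · rcases w1 with dx1 | dx2 | h
      · exact case14 dx1 dx4
      · exact case24 dx2 dx4
      · exact dx3 h

end Summit.ValiantsHypothesis.ValiantsHypothesis.Theorems.GrenetZeon.SlowFourSeven

end
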